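import Summits.Ventures.PercRepro.RLSRuleOneLineSixGeom
import Summits.Ventures.PercRepro.RLSRuleTwoLinesAnyGeom

/-!
# C-025 at q = 3: the `6`-point planes with two `3`-point lines — family and counting (night-3, gen 4)

`G` with `|G| = 6` and exactly two `3`-point lines `ℓ, ℓ′` (`TwoLinesAny`), meeting in `c := |ℓ ∩ ℓ′| ∈ {0, 1}` points
(catalogue #12: a common point; #14: disjoint).  Its rank-`3` subsets: `18` independent triples, `15` four-subsets
(`3` through each line, none through both), `6` five-subsets (`c` through both — the set `ℓ ∪ ℓ′` when `c = 1` —,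
`3 − c` through `ℓ` only, `3 − c` through `ℓ′` only, `c` through neither), and `G`.

* `depTriples_eq_pair_of_twoLinesAny`, `card_filter_five_both` (`= c`), `twoLinesSix_family`;
* `sum_powersetCard_four_twoSix` (`3vL + 3vL′ + 9vg`), `sum_powersetCard_five_twoSix`
  (`c·vLL + (3 − c)vL + (3 − c)vL′ + c·vg`).
Imports `RLSRuleOneLineSixGeom`, `RLSRuleTwoLinesAnyGeom`.  Axioms: standard.
-/

open scoped Matroid

namespace PercRepro

namespace NightThree

open Finset ThmH PerFlat

variable {α : Type*} [DecidableEq α] {M : Matroid α} [M.Finite]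

open scoped Classical in
omit [M.Finite] in
/-- The dependent triples of a `TwoLinesAny` plane are exactly its two lines. -/
theorem depTriples_eq_pair_of_twoLinesAny {G ℓ ℓ' : Finset α} (h : TwoLinesAny M G ℓ ℓ') :
    depTriples M G = {ℓ, ℓ'} := by
  obtain ⟨hℓG, hℓ'G, hℓc, hℓ'c, hℓr, hℓ'r, hne, hsimple, hind⟩ := h
  ext T
  unfold depTriples
  rw [Finset.mem_filter, Finset.mem_powersetCard, Finset.mem_insert, Finset.mem_singleton]
  constructor
  · rintro ⟨⟨hTG, hTc⟩, hdep⟩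
    by_contra hne'
    push Not at hne'
    exact hdep (hind T (Finset.mem_powersetCard.2 ⟨hTG, hTc⟩) hne'.1 hne'.2)
  · rintro (rfl | rfl)
    · exact ⟨⟨hℓG, hℓc⟩, not_indep_of_eRk_two_card_three hℓr hℓc⟩
    · exact ⟨⟨hℓ'G, hℓ'c⟩, not_indep_of_eRk_two_card_three hℓ'r hℓ'c⟩

/-- The `5`-subsets of a `6`-point `TwoLinesAny` plane through BOTH lines number `|ℓ ∩ ℓ′|`. -/
theorem card_filter_five_both {G ℓ ℓ' : Finset α} (hG : G ∈ flatsQ M 3) (h : TwoLinesAny M G ℓ ℓ') :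
    ((G.powersetCard 5).filter (fun B => ℓ ⊆ B ∧ ℓ' ⊆ B)).card = (ℓ ∩ ℓ').card := by
  classical
  have hmeet := card_inter_le_one_of_twoLines' hG h
  obtain ⟨hℓG, hℓ'G, hℓc, hℓ'c, hℓr, hℓ'r, hne, hsimple, hind⟩ := h
  have hu := Finset.card_union_add_card_inter ℓ ℓ'
  rcases Nat.lt_or_ge (ℓ ∩ ℓ').card 1 with h0 | h1
  · -- disjoint: `|ℓ ∪ ℓ′| = 6`, no `5`-subset contains both
    have hc0 : (ℓ ∩ ℓ').card = 0 := by omega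
    rw [hc0]
    apply Finset.card_eq_zero.2
    rw [Finset.eq_empty_iff_forall_notMem]
    intro B hB
    rw [Finset.mem_filter, Finset.mem_powersetCard] at hB
    obtain ⟨⟨_, hBc⟩, hl, hl'⟩ := hB
    have := Finset.card_le_card (Finset.union_subset hl hl')
    omega
  · -- a common point: `|ℓ ∪ ℓ′| = 5`, the unique `5`-subset through both is `ℓ ∪ ℓ′`
    have hc1 : (ℓ ∩ ℓ').card = 1 := by omega
    rw [hc1]
    apply Finset.card_eq_one.2
    refine ⟨ℓ ∪ ℓ', ?_⟩
    ext B
    rw [Finset.mem_filter, Finset.mem_powersetCard, Finset.mem_singleton]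
    constructor
    · rintro ⟨⟨hBG, hBc⟩, hl, hl'⟩
      symm
      exact Finset.eq_of_subset_of_card_le (Finset.union_subset hl hl') (by omega)
    · rintro rfl
      exact ⟨⟨Finset.union_subset hℓG hℓ'G, by omega⟩, Finset.subset_union_left, Finset.subset_union_right⟩

/-- The family of rank-`3` subsets of a `6`-point `TwoLinesAny` plane: ranks, disjointness, cards. -/
theorem twoLinesSix_family {p : ℕ} (hc : Core M p) {G ℓ ℓ' : Finset α} (hG : G ∈ flatsQ M 3)
    (h : TwoLinesAny M G ℓ ℓ') (hGc : G.card = 6) :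
    (∀ B ∈ ((G.powersetCard 3).erase ℓ).erase ℓ', B ⊆ G ∧ B.card = 3 ∧ ¬ ℓ ⊆ B ∧ ¬ ℓ' ⊆ B ∧ M.Indep (B : Set α)) ∧
    (∀ B ∈ ((G.powersetCard 3).erase ℓ).erase ℓ' ∪ G.powersetCard 4 ∪ G.powersetCard 5 ∪ {G},
      B ⊆ G ∧ M.eRk (B : Set α) = 3) ∧
    Disjoint (((G.powersetCard 3).erase ℓ).erase ℓ') (G.powersetCard 4) ∧
    Disjoint (((G.powersetCard 3).erase ℓ).erase ℓ' ∪ G.powersetCard 4) (G.powersetCard 5) ∧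
    Disjoint (((G.powersetCard 3).erase ℓ).erase ℓ' ∪ G.powersetCard 4 ∪ G.powersetCard 5) {G} ∧
    (((G.powersetCard 3).erase ℓ).erase ℓ').card = 18 ∧ (G.powersetCard 4).card = 15 ∧ (G.powersetCard 5).card = 6 := by
  classical
  obtain ⟨hℓG, hℓ'G, hℓc, hℓ'c, hℓr, hℓ'r, hne, hsimple, hind⟩ := h
  have hG3 : M.eRk (G : Set α) = 3 := eRk_eq_three_of_mem_flatsQ' hG
  have hmem3 : ∀ B ∈ ((G.powersetCard 3).erase ℓ).erase ℓ',
      B ⊆ G ∧ B.card = 3 ∧ ¬ ℓ ⊆ B ∧ ¬ ℓ' ⊆ B ∧ M.Indep (B : Set α) := by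
    intro B hB
    rw [Finset.mem_erase, Finset.mem_erase, Finset.mem_powersetCard] at hB
    obtain ⟨hBℓ', hBℓ, hBG, hBc⟩ := hB
    refine ⟨hBG, hBc, ?_, ?_, hind B (Finset.mem_powersetCard.2 ⟨hBG, hBc⟩) hBℓ hBℓ'⟩
    · intro hl; exact hBℓ (Finset.eq_of_subset_of_card_le hl (by omega)).symm
    · intro hl; exact hBℓ' (Finset.eq_of_subset_of_card_le hl (by omega)).symm
  have hc4 : ∀ B ∈ G.powersetCard 4, B.card = 4 := fun B hB => (Finset.mem_powersetCard.1 hB).2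
  have hc5 : ∀ B ∈ G.powersetCard 5, B.card = 5 := fun B hB => (Finset.mem_powersetCard.1 hB).2
  refine ⟨hmem3, ?_, ?_, ?_, ?_, ?_, ?_, ?_⟩
  · intro B hB
    simp only [Finset.mem_union, Finset.mem_singleton] at hB
    rcases hB with ((hB | hB) | hB) | hBG'
    · obtain ⟨hBG, hBc, _, _, hBind⟩ := hmem3 B hB
      exact ⟨hBG, eRk_eq_three_of_indep_card hBind hBc⟩
    · obtain ⟨hBG, hBc⟩ := Finset.mem_powersetCard.1 hB
      exact ⟨hBG, eRk_eq_three_of_four_le_of_core hc hG hBG (by omega)⟩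
    · obtain ⟨hBG, hBc⟩ := Finset.mem_powersetCard.1 hB
      exact ⟨hBG, eRk_eq_three_of_four_le_of_core hc hG hBG (by omega)⟩
    · rw [hBG']; exact ⟨le_rfl, hG3⟩
  · rw [Finset.disjoint_left]
    intro B h3 h4
    have := (hmem3 B h3).2.1; have := hc4 B h4; omega
  · rw [Finset.disjoint_left]
    intro B hB h5
    have := hc5 B h5
    rcases Finset.mem_union.1 hB with h3 | h4
    · have := (hmem3 B h3).2.1; omega
    · have := hc4 B h4; omega
  · rw [Finset.disjoint_right]
    intro B hB
    rw [Finset.mem_singleton] at hB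
    rw [hB]
    simp only [Finset.mem_union, not_or]
    refine ⟨⟨?_, ?_⟩, ?_⟩
    · intro h3; have := (hmem3 G h3).2.1; omega
    · intro h4; have := hc4 G h4; omega
    · intro h5; have := hc5 G h5; omega
  · rw [Finset.card_erase_of_mem, Finset.card_erase_of_mem (Finset.mem_powersetCard.2 ⟨hℓG, hℓc⟩),
      Finset.card_powersetCard, hGc]
    · rfl
    · rw [Finset.mem_erase, Finset.mem_powersetCard]; exact ⟨hne.symm, hℓ'G, hℓ'c⟩
  · rw [Finset.card_powersetCard, hGc]; rfl
  · rw [Finset.card_powersetCard, hGc]; rfl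

/-- Summing over the `4`-subsets of a `6`-point `TwoLinesAny` plane: `3` through `ℓ`, `3` through `ℓ′`, `9` through
neither (no `4`-subset contains both lines). -/
theorem sum_powersetCard_four_twoSix {G ℓ ℓ' : Finset α} (hG : G ∈ flatsQ M 3) (h : TwoLinesAny M G ℓ ℓ')
    (hGc : G.card = 6) (g : Finset α → ℚ) {vL vL' vg : ℚ}
    (hL : ∀ B ∈ G.powersetCard 4, ℓ ⊆ B → g B = vL) (hL' : ∀ B ∈ G.powersetCard 4, ℓ' ⊆ B → g B = vL')
    (hg : ∀ B ∈ G.powersetCard 4, ¬ ℓ ⊆ B → ¬ ℓ' ⊆ B → g B = vg) :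
    ∑ B ∈ G.powersetCard 4, g B = 3 * vL + 3 * vL' + 9 * vg := by
  classical
  have hmeet := card_inter_le_one_of_twoLines' hG h
  obtain ⟨hℓG, hℓ'G, hℓc, hℓ'c, hℓr, hℓ'r, hne, hsimple, hind⟩ := h
  have hu := Finset.card_union_add_card_inter ℓ ℓ'
  have hnotboth : ∀ B ∈ G.powersetCard 4, ¬ (ℓ ⊆ B ∧ ℓ' ⊆ B) := by
    rintro B hB ⟨hl, hl'⟩
    have := Finset.card_le_card (Finset.union_subset hl hl')
    rw [(Finset.mem_powersetCard.1 hB).2] at this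
    omega
  set P := G.powersetCard 4 with hP
  have hPc : P.card = 15 := by rw [hP, Finset.card_powersetCard, hGc]; rfl
  have hcL : (P.filter (fun B => ℓ ⊆ B)).card = 3 := card_filter_four_line_six hℓG hℓc hGc
  have hcL' : (P.filter (fun B => ℓ' ⊆ B)).card = 3 := card_filter_four_line_six hℓ'G hℓ'c hGc
  have hfilt : (P.filter (fun B => ¬ ℓ ⊆ B)).filter (fun B => ℓ' ⊆ B) = P.filter (fun B => ℓ' ⊆ B) := by
    ext B
    simp only [Finset.mem_filter]
    constructor
    · rintro ⟨⟨hB, _⟩, hl'⟩; exact ⟨hB, hl'⟩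
    · rintro ⟨hB, hl'⟩; exact ⟨⟨hB, fun hl => hnotboth B hB ⟨hl, hl'⟩⟩, hl'⟩
  have hcrest : ((P.filter (fun B => ¬ ℓ ⊆ B)).filter (fun B => ¬ ℓ' ⊆ B)).card = 9 := by
    have h1 := Finset.card_filter_add_card_filter_not (s := P) (fun B => ℓ ⊆ B)
    have h2 := Finset.card_filter_add_card_filter_not (s := P.filter (fun B => ¬ ℓ ⊆ B)) (fun B => ℓ' ⊆ B)
    rw [hfilt, hcL'] at h2
    rw [hcL, hPc] at h1
    omega
  rw [← Finset.sum_filter_add_sum_filter_not P (fun B => ℓ ⊆ B),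
    ← Finset.sum_filter_add_sum_filter_not (P.filter (fun B => ¬ ℓ ⊆ B)) (fun B => ℓ' ⊆ B), hfilt]
  rw [Finset.sum_congr rfl (fun B hB => hL B (Finset.mem_filter.1 hB).1 (Finset.mem_filter.1 hB).2),
    Finset.sum_congr rfl (fun B hB => hL' B (Finset.mem_filter.1 hB).1 (Finset.mem_filter.1 hB).2),
    Finset.sum_congr rfl (fun B hB => hg B (Finset.mem_filter.1 (Finset.mem_filter.1 hB).1).1
      (Finset.mem_filter.1 (Finset.mem_filter.1 hB).1).2 (Finset.mem_filter.1 hB).2),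
    Finset.sum_const, Finset.sum_const, Finset.sum_const, hcL, hcL', hcrest]
  simp only [nsmul_eq_mul]
  push_cast
  ring

/-- Summing over the `5`-subsets of a `6`-point `TwoLinesAny` plane with `c = |ℓ ∩ ℓ′|`: `c` through both lines,
`3 − c` through `ℓ` only, `3 − c` through `ℓ′` only, `c` through neither. -/
theorem sum_powersetCard_five_twoSix {G ℓ ℓ' : Finset α} (hG : G ∈ flatsQ M 3) (h : TwoLinesAny M G ℓ ℓ')
    (hGc : G.card = 6) (g : Finset α → ℚ) {vLL vL vL' vg : ℚ}
    (hLL : ∀ B ∈ G.powersetCard 5, ℓ ⊆ B → ℓ' ⊆ B → g B = vLL)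
    (hL : ∀ B ∈ G.powersetCard 5, ℓ ⊆ B → ¬ ℓ' ⊆ B → g B = vL)
    (hL' : ∀ B ∈ G.powersetCard 5, ¬ ℓ ⊆ B → ℓ' ⊆ B → g B = vL')
    (hg : ∀ B ∈ G.powersetCard 5, ¬ ℓ ⊆ B → ¬ ℓ' ⊆ B → g B = vg) :
    ∑ B ∈ G.powersetCard 5, g B = ((ℓ ∩ ℓ').card : ℚ) * vLL + (3 - ((ℓ ∩ ℓ').card : ℚ)) * vL +
      (3 - ((ℓ ∩ ℓ').card : ℚ)) * vL' + ((ℓ ∩ ℓ').card : ℚ) * vg := by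
  classical
  have hmeet := card_inter_le_one_of_twoLines' hG h
  have hboth := card_filter_five_both hG h
  obtain ⟨hℓG, hℓ'G, hℓc, hℓ'c, hℓr, hℓ'r, hne, hsimple, hind⟩ := h
  set P := G.powersetCard 5 with hP
  set c := (ℓ ∩ ℓ').card with hcdef
  have hPc : P.card = 6 := by rw [hP, Finset.card_powersetCard, hGc]; rfl
  have hcL : (P.filter (fun B => ℓ ⊆ B)).card = 3 := card_filter_five_line_six hℓG hℓc hGc
  have hcL' : (P.filter (fun B => ℓ' ⊆ B)).card = 3 := card_filter_five_line_six hℓ'G hℓ'c hGc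
  -- the four cells
  have hAB : ((P.filter (fun B => ℓ ⊆ B)).filter (fun B => ℓ' ⊆ B)).card = c := by
    rw [Finset.filter_filter]; exact hboth
  have hA : ((P.filter (fun B => ℓ ⊆ B)).filter (fun B => ¬ ℓ' ⊆ B)).card = 3 - c := by
    have := Finset.card_filter_add_card_filter_not (s := P.filter (fun B => ℓ ⊆ B)) (fun B => ℓ' ⊆ B)
    rw [hAB, hcL] at this
    omega
  have hA' : ((P.filter (fun B => ¬ ℓ ⊆ B)).filter (fun B => ℓ' ⊆ B)).card = 3 - c := by
    have hsplit : P.filter (fun B => ℓ' ⊆ B) =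
        (P.filter (fun B => ℓ ⊆ B)).filter (fun B => ℓ' ⊆ B) ∪
        (P.filter (fun B => ¬ ℓ ⊆ B)).filter (fun B => ℓ' ⊆ B) := by
      ext B
      simp only [Finset.mem_union, Finset.mem_filter]
      tauto
    have hdisj : Disjoint ((P.filter (fun B => ℓ ⊆ B)).filter (fun B => ℓ' ⊆ B))
        ((P.filter (fun B => ¬ ℓ ⊆ B)).filter (fun B => ℓ' ⊆ B)) := by
      rw [Finset.disjoint_left]
      intro B h1 h2
      simp only [Finset.mem_filter] at h1 h2
      exact h2.1.2 h1.1.2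
    have := Finset.card_union_of_disjoint hdisj
    rw [← hsplit, hcL', hAB] at this
    omega
  have hrest : ((P.filter (fun B => ¬ ℓ ⊆ B)).filter (fun B => ¬ ℓ' ⊆ B)).card = c := by
    have h1 := Finset.card_filter_add_card_filter_not (s := P) (fun B => ℓ ⊆ B)
    have h2 := Finset.card_filter_add_card_filter_not (s := P.filter (fun B => ¬ ℓ ⊆ B)) (fun B => ℓ' ⊆ B)
    rw [hA'] at h2
    rw [hcL, hPc] at h1
    omega
  rw [← Finset.sum_filter_add_sum_filter_not P (fun B => ℓ ⊆ B),
    ← Finset.sum_filter_add_sum_filter_not (P.filter (fun B => ℓ ⊆ B)) (fun B => ℓ' ⊆ B),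
    ← Finset.sum_filter_add_sum_filter_not (P.filter (fun B => ¬ ℓ ⊆ B)) (fun B => ℓ' ⊆ B)]
  rw [Finset.sum_congr rfl (fun B hB => hLL B (Finset.mem_filter.1 (Finset.mem_filter.1 hB).1).1
      (Finset.mem_filter.1 (Finset.mem_filter.1 hB).1).2 (Finset.mem_filter.1 hB).2),
    Finset.sum_congr rfl (fun B hB => hL B (Finset.mem_filter.1 (Finset.mem_filter.1 hB).1).1
      (Finset.mem_filter.1 (Finset.mem_filter.1 hB).1).2 (Finset.mem_filter.1 hB).2),
    Finset.sum_congr rfl (fun B hB => hL' B (Finset.mem_filter.1 (Finset.mem_filter.1 hB).1).1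
      (Finset.mem_filter.1 (Finset.mem_filter.1 hB).1).2 (Finset.mem_filter.1 hB).2),
    Finset.sum_congr rfl (fun B hB => hg B (Finset.mem_filter.1 (Finset.mem_filter.1 hB).1).1
      (Finset.mem_filter.1 (Finset.mem_filter.1 hB).1).2 (Finset.mem_filter.1 hB).2),
    Finset.sum_const, Finset.sum_const, Finset.sum_const, Finset.sum_const, hAB, hA, hA', hrest]
  simp only [nsmul_eq_mul]
  have hc1 : c ≤ 1 := hmeet
  push_cast [Nat.cast_sub (show c ≤ 3 by omega)]
  ring

end NightThree

end PercRepro
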